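import Mathlib
import Summits.NavierStokesRegularity.NavierStokesRegularity.Theorems.ThreadingFluxLoopLawBracketSlots
import HarnessLib

/-!
# Crux `PoloidalLiouville` (stmt-NavierStokesRegularity-1222, W1/W2), crux idea «linear-loop-law» (ns-idea-15):
# K-alg ALL DEGREES, kernel part 2 — THE SLOT-PAIR IDENTITY and PAIR RIGIDITY in the complex coordinates `(W, V, Z)`

Support file (Theorems-side tooling; seat ns-wall-eng-3 g3, cell ns-wall-extremal, W1 adjunct; `--supports
stmt-NavierStokesRegularity-1222`, helper).  Setting = ns-wall-eng-5 g4's complex-coordinate algebra (`…ZonalAlgebra/Slot/Descent.lean`)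
and the pair tools of `ThreadingFluxLoopLawBracketSlots.lean`.  NEW here (pure polynomial algebra, uniform in the degree `l`):

* ★ `tripleC_slots_ne_zero` — THE SLOT-PAIR IDENTITY: for non-zero `Δ̃`-harmonic polynomials `X` (pure weight `μ`), `Y` (pure weight
  `ν ≠ μ`) of the same degree `l`, `tripleC X Y ≠ 0`.  Cases: `0 ≤ ν < μ` (`tripleC_slots_ne_zero_nat`) — the value at the axis
  point `(1,0,1)` is `l(l+1)(μ−ν)(μ+ν+1)·a₀b₀ / (2(μ+1)(ν+1))` (jets + recursion (1.2)); `ν < μ ≤ 0` — mirror; `ν ≤ −1 < 1 ≤ μ`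
  (`tripleC_slots_ne_zero_mixed`) — the coefficient of `W^{μ−1} V^{|ν|−1} Z^{2l+1−μ−|ν|}` is `−2μ|ν|·a₀b₀` (`W`-exponent lower
  bounds);
* ★★ `pair_rigidity` — two `Δ̃`-harmonic homogeneous polynomials of the same degree with `tripleC P Q = 0`, `P ≠ 0`, are
  proportional: descent on the top azimuthal weight of `Q` inside `span{P, Q}` (equal top weights are subtracted away by
  `slot_proportional`; distinct top weights contradict the slot-pair identity through `wcomp_tripleC_top`).

This is the algebraic core of `SameDegreeBracketRigidity` (LoopLawSketch l.107, ALL `l`), assembled in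
`ThreadingFluxLoopLawSameDegreeBracketRigidity.lean`.  HONEST LABEL: finite-dimensional algebra about one crux idea's typed objects;
`PoloidalLiouville` (1222), `UnthreadedRigidity` (27585) and NS regularity remain OPEN; W1/W2 movement 0.  [folklore]
-/

-- the summit and its single problem share the name (D-0017 nested layout)
set_option linter.dupNamespace false

noncomputable section

open MvPolynomial Finsupp

namespace Summit.NavierStokesRegularity.NavierStokesRegularity.Theorems.PoloidalLiouville.HorizonTower.Zonal

/-! ### The slot-pair identity -/

section SlotPair

/-- **Slot pair, both weights non-negative** (`0 ≤ M' < M`): for non-zero harmonic slots `X` (weight `M`, degree `M + dd`) and `Y`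
(weight `M'`, degree `M' + dd' = M + dd`), `tripleC X Y ≠ 0` — its value at the axis point is
`l(l+1)(M−M')(M+M'+1)·a₀b₀ / (2(M+1)(M'+1))`, `l = M + dd`. -/
theorem tripleC_slots_ne_zero_nat {X Y : CPoly} {M M' dd dd' : ℕ}
    (hXw : IsWeightedHomogeneous wt X (M : ℤ)) (hXh : X.IsHomogeneous (M + dd)) (hXl : lapC X = 0) (hX0 : X ≠ 0)
    (hYw : IsWeightedHomogeneous wt Y (M' : ℤ)) (hYh : Y.IsHomogeneous (M' + dd')) (hYl : lapC Y = 0) (hY0 : Y ≠ 0)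
    (he : M + dd = M' + dd') (hlt : M' < M) : tripleC X Y ≠ 0 := by
  intro hT
  set a0 := coeff (sx M dd 0) X with ha0
  set a1 := coeff (sx M dd 1) X with ha1
  set b0 := coeff (sx M' dd' 0) Y with hb0
  set b1 := coeff (sx M' dd' 1) Y with hb1
  have ha : a0 ≠ 0 := coeff_sx_zero_ne_zero hXw hXh hXl hX0
  have hb : b0 ≠ 0 := coeff_sx_zero_ne_zero hYw hYh hYl hY0
  -- the value of `tripleC X Y` at the axis point
  have hE := congrArg (eval axisPt) hT
  rw [tripleC, lam_eq_smul_of_isWeightedHomogeneous hXw, lam_eq_smul_of_isWeightedHomogeneous hYw, smul_eq_C_mul,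
    smul_eq_C_mul, map_zero] at hE
  simp only [map_add, map_sub, map_mul, eval_C, eval_X, axisPt_two, jet_val hXw hXh, jet_val hYw hYh, jet_d0' hXw hXh,
    jet_d0' hYw hYh, jet_d1 hXw hXh, jet_d1 hYw hYh, jet_d2' hXw hXh, jet_d2' hYw hYh] at hE
  rw [← ha0, ← ha1, ← hb0, ← hb1] at hE
  have RX := slot_recursion_zero (M := M) (dd := dd) hXh hXl
  have RY := slot_recursion_zero (M := M') (dd := dd') hYh hYl
  rw [← ha0, ← ha1] at RX
  rw [← hb0, ← hb1] at RY
  -- memo-style closed form, before using `M + dd = M' + dd'`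
  have hΦ : a0 * b0 * ((M : ℂ) * (M + 1) * dd' * (dd' + 2 * M' + 1) - (M' : ℂ) * (M' + 1) * dd * (dd + 2 * M + 1)) = 0 := by
    linear_combination (2 * ((M : ℂ) + 1) * ((M' : ℂ) + 1)) * hE - (((M' : ℂ) + 1) * M' * b0) * RX
      + (((M : ℂ) + 1) * M * a0) * RY
  have he' : (M : ℂ) + dd = M' + dd' := by exact_mod_cast he
  have key : ((M : ℂ) + dd) * ((M : ℂ) + dd + 1) * ((M : ℂ) - M') * ((M : ℂ) + M' + 1) * (a0 * b0) = 0 := by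
    linear_combination hΦ + (a0 * b0 * (M : ℂ) * (M + 1) * ((M : ℂ) + dd + M' + dd' + 1)) * he'
  have h1 : ((M : ℂ) + dd) ≠ 0 := by exact_mod_cast (by omega : M + dd ≠ 0)
  have h2 : ((M : ℂ) + dd + 1) ≠ 0 := by exact_mod_cast (by omega : M + dd + 1 ≠ 0)
  have h3 : ((M : ℂ) - M') ≠ 0 := sub_ne_zero.mpr (by exact_mod_cast (by omega : M ≠ M'))
  have h4 : ((M : ℂ) + M' + 1) ≠ 0 := by exact_mod_cast (by omega : M + M' + 1 ≠ 0)
  have h5 : a0 * b0 ≠ 0 := mul_ne_zero ha hb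
  exact h5 ((mul_eq_zero.mp key).resolve_left (mul_ne_zero (mul_ne_zero (mul_ne_zero h1 h2) h3) h4))

/-! #### Mixed signs: `W`-exponent lower bounds and one coefficient -/

/-- A weight-`M` slot (`M ≥ 0`) has all `W`-exponents `≥ M`. [folklore] -/
theorem wexp_ge_of_slot {X : CPoly} {M dd : ℕ} (hXw : IsWeightedHomogeneous wt X (M : ℤ)) (hXh : X.IsHomogeneous (M + dd)) :
    ∀ d : Fin 3 →₀ ℕ, coeff d X ≠ 0 → M ≤ d 0 := by
  intro d hd
  obtain ⟨k, -, rfl⟩ := exists_sx_of_mem_support hXw hXh (MvPolynomial.mem_support_iff.mpr hd)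
  simp

/-- `∂_V` preserves a `W`-exponent lower bound. [folklore] -/
theorem wexp_ge_pderiv_one {P : CPoly} {a : ℕ} (h : ∀ d : Fin 3 →₀ ℕ, coeff d P ≠ 0 → a ≤ d 0) :
    ∀ d : Fin 3 →₀ ℕ, coeff d (pderiv 1 P) ≠ 0 → a ≤ d 0 := by
  intro d hd
  rw [coeff_pderiv] at hd
  have := h _ (left_ne_zero_of_mul hd)
  simpa using this

/-- `∂_Z` preserves a `W`-exponent lower bound. [folklore] -/
theorem wexp_ge_pderiv_two {P : CPoly} {a : ℕ} (h : ∀ d : Fin 3 →₀ ℕ, coeff d P ≠ 0 → a ≤ d 0) :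
    ∀ d : Fin 3 →₀ ℕ, coeff d (pderiv 2 P) ≠ 0 → a ≤ d 0 := by
  intro d hd
  rw [coeff_pderiv] at hd
  have := h _ (left_ne_zero_of_mul hd)
  simpa using this

/-- Scalars preserve a `W`-exponent lower bound. [folklore] -/
theorem wexp_ge_C_mul {P : CPoly} {a : ℕ} (h : ∀ d : Fin 3 →₀ ℕ, coeff d P ≠ 0 → a ≤ d 0) (c : ℂ) :
    ∀ d : Fin 3 →₀ ℕ, coeff d (C c * P) ≠ 0 → a ≤ d 0 := by
  intro d hd
  rw [coeff_C_mul] at hd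
  exact h _ (right_ne_zero_of_mul hd)

/-- A product with a right factor of `W`-exponents `≥ a` has no monomial of `W`-exponent `< a`. [folklore] -/
theorem coeff_mul_eq_zero_of_wexp_right {A B : CPoly} {a : ℕ} {e : Fin 3 →₀ ℕ}
    (hB : ∀ d : Fin 3 →₀ ℕ, coeff d B ≠ 0 → a ≤ d 0) (he : e 0 < a) : coeff e (A * B) = 0 := by
  classical
  rw [coeff_mul]
  refine Finset.sum_eq_zero fun x hx => ?_
  by_cases h : coeff x.2 B = 0
  · rw [h, mul_zero]
  · exfalso
    have h1 := hB _ h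
    have h2 : x.1 0 + x.2 0 = e 0 := by
      have := Finset.HasAntidiagonal.mem_antidiagonal.mp hx
      rw [← Finsupp.add_apply, this]
    omega

/-- A product with a left factor of `W`-exponents `≥ a` has no monomial of `W`-exponent `< a`. [folklore] -/
theorem coeff_mul_eq_zero_of_wexp_left {A B : CPoly} {a : ℕ} {e : Fin 3 →₀ ℕ}
    (hA : ∀ d : Fin 3 →₀ ℕ, coeff d A ≠ 0 → a ≤ d 0) (he : e 0 < a) : coeff e (A * B) = 0 := by
  rw [mul_comm]; exact coeff_mul_eq_zero_of_wexp_right hA he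

/-- Support of a NEGATIVE-weight slot: every monomial of a weight-`(−m)`, degree-`(m + dd)` polynomial is `W^j V^{m+j} Z^{dd−2j}`. -/
theorem exists_sy_of_mem_support {Y : CPoly} {m dd : ℕ} (hW : IsWeightedHomogeneous wt Y (-(m : ℤ))) (hY : Y.IsHomogeneous (m + dd))
    {d : Fin 3 →₀ ℕ} (hd : d ∈ Y.support) : ∃ j, 2 * j ≤ dd ∧ d = tri j (m + j) (dd - 2 * j) := by
  obtain ⟨h1, h2⟩ := exponent_of_mem_support hW hY hd
  refine ⟨d 0, by omega, ?_⟩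
  rw [eq_tri d, tri_eq_tri_iff, tri_apply_zero]
  omega

/-- A non-zero harmonic NEGATIVE-weight slot has non-zero leading coefficient `b₀ = coeff (V^m Z^dd)` (mirror of `coeff_sx_zero_ne_zero`). -/
theorem coeff_sy_zero_ne_zero {Y : CPoly} {m dd : ℕ} (hW : IsWeightedHomogeneous wt Y (-(m : ℤ))) (hY : Y.IsHomogeneous (m + dd))
    (hlap : lapC Y = 0) (hY0 : Y ≠ 0) : coeff (tri 0 m dd) Y ≠ 0 := by
  have hW' : IsWeightedHomogeneous wt (mirror Y) (m : ℤ) := by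
    convert isWeightedHomogeneous_mirror hW using 1; ring
  have hl' : lapC (mirror Y) = 0 := by rw [mirror_lapC, hlap, map_zero]
  have h0' : mirror Y ≠ 0 := fun h => hY0 ((mirror_eq_zero_iff Y).mp h)
  have h := coeff_sx_zero_ne_zero hW' hY.rename_isHomogeneous hl' h0'
  have e1 : sx m dd 0 = tri m 0 dd := by rw [sx, tri_eq_tri_iff]; omega
  rw [e1, coeff_tri_mirror] at h
  exact h

/-- **Slot pair, mixed signs** (`μ = M ≥ 1`, `ν = −m ≤ −1`): for non-zero harmonic slots `X` (weight `M`, degree `M + dd`) and `Y`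
(weight `−m`, degree `m + dd'`), `tripleC X Y ≠ 0` — the coefficient of `W^{M−1} V^{m−1} Z^{dd+dd'+1}` is `−2Mm·a₀b₀`. -/
theorem tripleC_slots_ne_zero_mixed {X Y : CPoly} {M m dd dd' : ℕ}
    (hXw : IsWeightedHomogeneous wt X (M : ℤ)) (hXh : X.IsHomogeneous (M + dd)) (hXl : lapC X = 0) (hX0 : X ≠ 0)
    (hYw : IsWeightedHomogeneous wt Y (-(m : ℤ))) (hYh : Y.IsHomogeneous (m + dd')) (hYl : lapC Y = 0) (hY0 : Y ≠ 0)
    (hM : 1 ≤ M) (hm : 1 ≤ m) : tripleC X Y ≠ 0 := by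
  classical
  intro hT
  set a0 := coeff (sx M dd 0) X with ha0
  set b0 := coeff (tri 0 m dd') Y with hb0
  have ha : a0 ≠ 0 := coeff_sx_zero_ne_zero hXw hXh hXl hX0
  have hb : b0 ≠ 0 := coeff_sy_zero_ne_zero hYw hYh hYl hY0
  have hXL := wexp_ge_of_slot hXw hXh
  set e : Fin 3 →₀ ℕ := tri (M - 1) (m - 1) (dd + dd' + 1) with he
  have he0 : e 0 < M := by rw [he, tri_apply_zero]; omega
  -- the four terms of `tripleC X Y` at the exponent `e`
  have h1 : coeff e (pderiv 2 Y * lam X) = 0 := by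
    rw [lam_eq_smul_of_isWeightedHomogeneous hXw, smul_eq_C_mul]
    exact coeff_mul_eq_zero_of_wexp_right (wexp_ge_C_mul hXL _) he0
  have h2 : coeff e (pderiv 2 X * lam Y) = 0 := coeff_mul_eq_zero_of_wexp_left (wexp_ge_pderiv_two hXL) he0
  set e' : Fin 3 →₀ ℕ := tri (M - 1) (m - 1) (dd + dd') with he'
  have hee' : e - single 2 1 = e' := by
    rw [he, he']; ext i; fin_cases i <;> simp
  have he'0 : e' 0 < M := by rw [he', tri_apply_zero]; omega
  have h3 : coeff e' (pderiv 1 X * pderiv 0 Y) = 0 := coeff_mul_eq_zero_of_wexp_left (wexp_ge_pderiv_one hXL) he'0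
  -- the surviving product
  set p : Fin 3 →₀ ℕ := tri (M - 1) 0 dd with hp
  set q : Fin 3 →₀ ℕ := tri 0 (m - 1) dd' with hq
  have hpq : p + q = e' := by rw [hp, hq, he']; ext i; fin_cases i <;> simp
  have hcp : coeff p (pderiv 0 X) = (M : ℂ) * a0 := by
    rw [coeff_pderiv, hp, tri_add_single_zero, tri_apply_zero, Nat.sub_add_cancel hM, ha0, sx]
    have : tri (M + 0) 0 (dd - 2 * 0) = tri M 0 dd := by rw [tri_eq_tri_iff]; omega
    rw [this, Nat.cast_sub hM]; push_cast; ring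
  have hcq : coeff q (pderiv 1 Y) = (m : ℂ) * b0 := by
    rw [coeff_pderiv, hq, tri_add_single_one, tri_apply_one, Nat.sub_add_cancel hm, hb0, Nat.cast_sub hm]
    push_cast; ring
  have h4 : coeff e' (pderiv 0 X * pderiv 1 Y) = (M : ℂ) * a0 * ((m : ℂ) * b0) := by
    rw [coeff_mul, Finset.sum_eq_single (p, q)]
    · rw [hcp, hcq]
    · rintro ⟨p', q'⟩ hmem hne
      by_contra hprod
      have hp' : coeff p' (pderiv 0 X) ≠ 0 := left_ne_zero_of_mul hprod
      have hq' : coeff q' (pderiv 1 Y) ≠ 0 := right_ne_zero_of_mul hprod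
      rw [coeff_pderiv] at hp' hq'
      obtain ⟨k, hk, hpk⟩ := exists_sx_of_mem_support hXw hXh (MvPolynomial.mem_support_iff.mpr (left_ne_zero_of_mul hp'))
      obtain ⟨j, hj, hqj⟩ := exists_sy_of_mem_support hYw hYh (MvPolynomial.mem_support_iff.mpr (left_ne_zero_of_mul hq'))
      have hsum : p' + q' = e' := Finset.HasAntidiagonal.mem_antidiagonal.mp hmem
      have e0 := congrArg (fun d => d 0) hsum
      have e1 := congrArg (fun d => d 1) hsum
      have e2 := congrArg (fun d => d 2) hsum
      have k0 := congrArg (fun d => d 0) hpk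
      have k1 := congrArg (fun d => d 1) hpk
      have k2 := congrArg (fun d => d 2) hpk
      have j0 := congrArg (fun d => d 0) hqj
      have j1 := congrArg (fun d => d 1) hqj
      have j2 := congrArg (fun d => d 2) hqj
      simp only [Finsupp.add_apply, Finsupp.single_apply, he', tri_apply_zero, tri_apply_one, tri_apply_two, sx_zero, sx_one,
        sx_two] at e0 e1 e2 k0 k1 k2 j0 j1 j2
      simp only [Fin.isValue, ↓reduceIte, Fin.zero_eq_one_iff, OfNat.ofNat_ne_one, one_ne_zero,
        Fin.reduceEq, add_zero] at k0 k1 k2 j0 j1 j2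
      apply hne
      have hp'' : p' = p := by
        rw [hp, eq_tri p', tri_eq_tri_iff]; omega
      have hq'' : q' = q := by
        rw [hq, eq_tri q', tri_eq_tri_iff]; omega
      rw [hp'', hq'']
    · intro h
      exact absurd (Finset.HasAntidiagonal.mem_antidiagonal.mpr hpq) h
  have h5 : coeff e (C (2 : ℂ) * MvPolynomial.X 2 * (pderiv 1 X * pderiv 0 Y - pderiv 0 X * pderiv 1 Y))
      = 2 * (0 - (M : ℂ) * a0 * ((m : ℂ) * b0)) := by
    rw [mul_assoc, coeff_C_mul, coeff_X_mul', if_pos (by rw [Finsupp.mem_support_iff, he, tri_apply_two]; omega), hee',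
      coeff_sub, h3, h4]
  have hc := congrArg (coeff e) hT
  rw [tripleC, coeff_zero, coeff_add, coeff_sub, h1, h2, h5] at hc
  have hM' : (M : ℂ) ≠ 0 := by exact_mod_cast (by omega : M ≠ 0)
  have hm' : (m : ℂ) ≠ 0 := by exact_mod_cast (by omega : m ≠ 0)
  have : (M : ℂ) * a0 * ((m : ℂ) * b0) = 0 := by linear_combination (-1 / 2 : ℂ) * hc
  exact mul_ne_zero (mul_ne_zero hM' ha) (mul_ne_zero hm' hb) this

/-! #### All sign patterns -/

/-- Slot pair, ordered weights `ν < μ`. -/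
theorem tripleC_slots_ne_zero_of_lt {X Y : CPoly} {μ ν : ℤ} {l : ℕ}
    (hXw : IsWeightedHomogeneous wt X μ) (hXh : X.IsHomogeneous l) (hXl : lapC X = 0) (hX0 : X ≠ 0)
    (hYw : IsWeightedHomogeneous wt Y ν) (hYh : Y.IsHomogeneous l) (hYl : lapC Y = 0) (hY0 : Y ≠ 0)
    (hlt : ν < μ) : tripleC X Y ≠ 0 := by
  obtain ⟨hXlo, hXhi⟩ := weight_le_degree hXw hXh hX0
  obtain ⟨hYlo, hYhi⟩ := weight_le_degree hYw hYh hY0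
  rcases le_or_gt 0 ν with hν | hν
  · -- `0 ≤ ν < μ`
    obtain ⟨M, rfl⟩ : ∃ M : ℕ, μ = M := ⟨μ.toNat, (Int.toNat_of_nonneg (by omega)).symm⟩
    obtain ⟨N, rfl⟩ : ∃ N : ℕ, ν = N := ⟨ν.toNat, (Int.toNat_of_nonneg hν).symm⟩
    obtain ⟨dd, hdd⟩ : ∃ dd : ℕ, l = M + dd := ⟨l - M, by omega⟩
    obtain ⟨dd', hdd'⟩ : ∃ dd' : ℕ, l = N + dd' := ⟨l - N, by omega⟩
    exact tripleC_slots_ne_zero_nat hXw (hdd ▸ hXh) hXl hX0 hYw (hdd' ▸ hYh) hYl hY0 (by omega) (by exact_mod_cast hlt)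
  · rcases le_or_gt 1 μ with hμ | hμ
    · -- `ν ≤ -1`, `1 ≤ μ`: mixed signs
      obtain ⟨M, rfl⟩ : ∃ M : ℕ, μ = M := ⟨μ.toNat, (Int.toNat_of_nonneg (by omega)).symm⟩
      obtain ⟨m, hm⟩ : ∃ m : ℕ, ν = -(m : ℤ) := ⟨(-ν).toNat, by rw [Int.toNat_of_nonneg (by omega)]; ring⟩
      obtain ⟨dd, hdd⟩ : ∃ dd : ℕ, l = M + dd := ⟨l - M, by omega⟩
      obtain ⟨dd', hdd'⟩ : ∃ dd' : ℕ, l = m + dd' := ⟨l - m, by omega⟩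
      exact tripleC_slots_ne_zero_mixed hXw (hdd ▸ hXh) hXl hX0 (hm ▸ hYw) (hdd' ▸ hYh) hYl hY0 (by exact_mod_cast hμ)
        (by omega)
    · -- `ν < μ ≤ 0`: mirror, then the non-negative case for the pair `(σY, σX)`
      obtain ⟨M, hM⟩ : ∃ M : ℕ, -ν = M := ⟨(-ν).toNat, (Int.toNat_of_nonneg (by omega)).symm⟩
      obtain ⟨N, hN⟩ : ∃ N : ℕ, -μ = N := ⟨(-μ).toNat, (Int.toNat_of_nonneg (by omega)).symm⟩
      obtain ⟨dd, hdd⟩ : ∃ dd : ℕ, l = M + dd := ⟨l - M, by omega⟩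
      obtain ⟨dd', hdd'⟩ : ∃ dd' : ℕ, l = N + dd' := ⟨l - N, by omega⟩
      have hYw' : IsWeightedHomogeneous wt (mirror Y) (M : ℤ) := hM ▸ isWeightedHomogeneous_mirror hYw
      have hXw' : IsWeightedHomogeneous wt (mirror X) (N : ℤ) := hN ▸ isWeightedHomogeneous_mirror hXw
      have hXl' : lapC (mirror X) = 0 := by rw [mirror_lapC, hXl, map_zero]
      have hYl' : lapC (mirror Y) = 0 := by rw [mirror_lapC, hYl, map_zero]
      have hX0' : mirror X ≠ 0 := fun h => hX0 ((mirror_eq_zero_iff X).mp h)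
      have hY0' : mirror Y ≠ 0 := fun h => hY0 ((mirror_eq_zero_iff Y).mp h)
      have h := tripleC_slots_ne_zero_nat hYw' (hdd ▸ hYh.rename_isHomogeneous) hYl' hY0' hXw'
        (hdd' ▸ hXh.rename_isHomogeneous) hXl' hX0' (by omega) (by exact_mod_cast (show N < M by omega))
      intro hT
      apply h
      rw [mirror_tripleC, tripleC_swap, hT, neg_zero, map_zero, neg_zero]

/-- ★ **THE SLOT-PAIR IDENTITY**: two non-zero `Δ̃`-harmonic polynomials of the same degree and DISTINCT pure azimuthal weights have
`tripleC X Y ≠ 0`. -/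
theorem tripleC_slots_ne_zero {X Y : CPoly} {μ ν : ℤ} {l : ℕ}
    (hXw : IsWeightedHomogeneous wt X μ) (hXh : X.IsHomogeneous l) (hXl : lapC X = 0) (hX0 : X ≠ 0)
    (hYw : IsWeightedHomogeneous wt Y ν) (hYh : Y.IsHomogeneous l) (hYl : lapC Y = 0) (hY0 : Y ≠ 0)
    (hne : μ ≠ ν) : tripleC X Y ≠ 0 := by
  rcases lt_or_gt_of_ne hne with h | h
  · intro hT
    apply tripleC_slots_ne_zero_of_lt hYw hYh hYl hY0 hXw hXh hXl hX0 h
    rw [tripleC_swap, hT, neg_zero]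
  · exact tripleC_slots_ne_zero_of_lt hXw hXh hXl hX0 hYw hYh hYl hY0 h

end SlotPair

/-! ### Pair rigidity: the descent on the top weight -/

section Pair

variable {P Q : CPoly} {l : ℕ}

/-- Every monomial of a degree-`l` polynomial has weight `≤ l`. [folklore] -/
theorem WB.of_isHomogeneous (hQ : Q.IsHomogeneous l) : WB l Q := by
  intro d hd
  have h := hQ hd
  rw [weight_one_fin3] at h
  rw [weight_wt]
  omega

/-- A degree-`l` polynomial with all weights `≤ −l − 1` is zero. [folklore] -/
theorem eq_zero_of_WB_neg (hQ : Q.IsHomogeneous l) (hW : WB (-(l : ℤ) - 1) Q) : Q = 0 := by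
  by_contra hne
  obtain ⟨d, hd⟩ := exists_coeff_ne_zero hne
  have h1 := hW d hd
  have h2 := hQ hd
  rw [weight_one_fin3] at h2
  rw [weight_wt] at h1
  omega

/-- Sharpening a weight bound: if the top component vanishes, the bound drops by one. [folklore] -/
theorem WB.of_wcomp_eq_zero {β : ℤ} (hW : WB β Q) (h : weightedHomogeneousComponent wt β Q = 0) : WB (β - 1) Q := by
  classical
  intro d hd
  have h1 := hW d hd
  rcases lt_or_eq_of_le h1 with h2 | h2
  · omega
  · exfalso
    have : coeff d (weightedHomogeneousComponent wt β Q) = coeff d Q := by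
      rw [coeff_weightedHomogeneousComponent, if_pos h2]
    rw [h, coeff_zero] at this
    exact hd this.symm

/-- The top weight of a non-zero polynomial: a bound `μ` that is attained (non-zero component). [folklore] -/
theorem exists_top_weight (hP0 : P ≠ 0) : ∃ μ : ℤ, WB μ P ∧ weightedHomogeneousComponent wt μ P ≠ 0 := by
  classical
  set S : Finset ℤ := P.support.image (weight wt) with hS
  obtain ⟨d₀, hd₀⟩ := exists_coeff_ne_zero hP0
  have hSne : S.Nonempty := ⟨weight wt d₀, Finset.mem_image_of_mem _ (MvPolynomial.mem_support_iff.mpr hd₀)⟩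
  refine ⟨S.max' hSne, fun d hd => Finset.le_max' S _ (Finset.mem_image_of_mem _ (MvPolynomial.mem_support_iff.mpr hd)), ?_⟩
  obtain ⟨d₁, hd₁S, hd₁w⟩ : ∃ d₁ ∈ P.support, weight wt d₁ = S.max' hSne := by
    have := Finset.max'_mem S hSne
    simpa [hS] using this
  intro h
  have : coeff d₁ (weightedHomogeneousComponent wt (S.max' hSne) P) = coeff d₁ P := by
    rw [coeff_weightedHomogeneousComponent, if_pos hd₁w]
  rw [h, coeff_zero] at this
  exact (MvPolynomial.mem_support_iff.mp hd₁S) this.symm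

/-- The descent (induction on the weight bound of `Q`). -/
theorem pair_rigidity_aux (hP : P.IsHomogeneous l) (hPl : lapC P = 0) (hP0 : P ≠ 0) :
    ∀ n : ℕ, ∀ Q : CPoly, Q.IsHomogeneous l → lapC Q = 0 → tripleC P Q = 0 → WB ((n : ℤ) - l - 1) Q →
      ∃ c : ℂ, Q = C c * P := by
  classical
  obtain ⟨μ, hPμ, hPtop⟩ := exists_top_weight hP0
  have hPμw : IsWeightedHomogeneous wt (weightedHomogeneousComponent wt μ P) μ :=
    weightedHomogeneousComponent_isWeightedHomogeneous μ P
  have hPμh : (weightedHomogeneousComponent wt μ P).IsHomogeneous l := isHomogeneous_wcomp hP μ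
  have hPμl : lapC (weightedHomogeneousComponent wt μ P) = 0 := by rw [← wcomp_lapC, hPl, map_zero]
  intro n
  induction n with
  | zero =>
    intro Q hQ _ _ hW
    refine ⟨0, ?_⟩
    rw [eq_zero_of_WB_neg hQ (by simpa using hW), map_zero, zero_mul]
  | succ n ih =>
    intro Q hQ hQl hT hW
    set β : ℤ := (n : ℤ) - l with hβ
    have hW' : WB β Q := by convert hW using 1; push_cast; ring
    by_cases htop : weightedHomogeneousComponent wt β Q = 0
    · exact ih Q hQ hQl hT (by convert hW'.of_wcomp_eq_zero htop using 1)
    · have hQβw : IsWeightedHomogeneous wt (weightedHomogeneousComponent wt β Q) β :=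
        weightedHomogeneousComponent_isWeightedHomogeneous β Q
      have hQβh : (weightedHomogeneousComponent wt β Q).IsHomogeneous l := isHomogeneous_wcomp hQ β
      have hQβl : lapC (weightedHomogeneousComponent wt β Q) = 0 := by rw [← wcomp_lapC, hQl, map_zero]
      by_cases hβμ : β = μ
      · -- equal top weights: subtract the multiple of `P` that kills the top slot of `Q`
        obtain ⟨c₀, hc₀⟩ := slot_proportional hPμw hPμh hPμl hPtop (hβμ ▸ hQβw) hQβh hQβl
        set Q' := Q - C c₀ * P with hQ'
        have hQ'h : Q'.IsHomogeneous l := hQ.sub (hP.C_mul c₀)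
        have hQ'l : lapC Q' = 0 := by rw [hQ', lapC_sub_C_mul, hPl, hQl, mul_zero, sub_zero]
        have hQ'T : tripleC P Q' = 0 := by rw [hQ', tripleC_sub_C_mul_right, hT, tripleC_self, mul_zero, sub_zero]
        have hQ'W : WB β Q' := hW'.sub ((hPμ.mono (le_of_eq hβμ.symm)).C_mul c₀)
        have hQ'top : weightedHomogeneousComponent wt β Q' = 0 := by
          rw [hQ', map_sub, weightedHomogeneousComponent_C_mul, hc₀, hβμ, sub_self]
        obtain ⟨c, hc⟩ := ih Q' hQ'h hQ'l hQ'T (by convert hQ'W.of_wcomp_eq_zero hQ'top using 1)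
        refine ⟨c + c₀, ?_⟩
        rw [map_add, add_mul, ← hc, hQ']; ring
      · -- distinct top weights: the top component of `tripleC P Q` is a non-vanishing slot pair
        exfalso
        have htopT : weightedHomogeneousComponent wt (μ + β) (tripleC P Q)
            = tripleC (weightedHomogeneousComponent wt μ P) (weightedHomogeneousComponent wt β Q) :=
          wcomp_tripleC_top hPμ hW'
        rw [hT, map_zero] at htopT
        exact tripleC_slots_ne_zero hPμw hPμh hPμl hPtop hQβw hQβh hQβl htop (Ne.symm hβμ) htopT.symm

/-- ★★ **PAIR RIGIDITY** (the algebraic core of `SameDegreeBracketRigidity`, all degrees): two `Δ̃`-harmonic homogeneous polynomials of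
the same degree in `ℂ[W, V, Z]` whose transported triple product `tripleC P Q` (`= −i·det(∇P, ∇Q, x)`) vanishes, with `P ≠ 0`,
are proportional. -/
theorem pair_rigidity (hP : P.IsHomogeneous l) (hQ : Q.IsHomogeneous l) (hPl : lapC P = 0) (hQl : lapC Q = 0)
    (hT : tripleC P Q = 0) (hP0 : P ≠ 0) : ∃ c : ℂ, Q = C c * P :=
  pair_rigidity_aux hP hPl hP0 (2 * l + 1) Q hQ hQl hT
    (by convert WB.of_isHomogeneous hQ using 1; push_cast; ring)

end Pair

end Summit.NavierStokesRegularity.NavierStokesRegularity.Theorems.PoloidalLiouville.HorizonTower.Zonal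

end
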